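import Mathlib
import Literature.Geometry.DiscreteGeometry.TwoShellPatterns
import Literature.Geometry.DiscreteGeometry.TwoShellIntegerModel
import Literature.Geometry.DiscreteGeometry.TwoShellPlacementCheck
import Literature.MathematicalPhysics.StatisticalMechanics.BarlowStacking
import Summits.AtomisticToContinuum.Crystallization.Theorems.NashClassCertificatesNashNearFieldStubChartCoreBridge
import Summits.AtomisticToContinuum.Crystallization.Theorems.ReggeStarCoercivityDefectFreeCrystallizesLayeredGluing07

/-!
# Crux `PhononSlackCertificates.NearFieldConvexity` (stmt-13958), line `Sketch`, stub `stub_labelledPlacement` —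
# piece TEMPLATE-OF-CONTEXT (`stub_labelledPlacementTemplate`)

The chart core identifies, for a good centre, one LETTER CONTEXT `κ : TwoShellCheck.Ctx` of the computable `√18`
integer model (`Literature/Geometry/DiscreteGeometry/TwoShellPlacementCheck.lean`): a coordinate sign flip
`κ.flip` (which `⟨111⟩` body diagonal of the cuboctahedral frame is the layer normal) and the letters of layers
`−2, −1, 1, 2`.  This file REALISES every context of the two genuine families (4 for an hcp-type centre, 16 for an
fcc-type centre) by an actual ideal Barlow template: a linear isometry `R` and a Hägg word `s` with
(i) the centre's pattern inside `R(sites)`, (ii) the non-zero central sites carried into the pattern, and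
(iii) EVERY model vector accepted by `κ.isSite` equal to `R` of a template site:
`R (barlowPos 1 (√6/3) s m u w) = z/√18`.

Construction: `R = F ∘ cuboFrame` with `F` the coordinate sign flip of `κ.flip` (a linear isometry of `ℝ³`
preserving `fccTwoShellPattern`; the identity for hcp contexts); `s 0 = 1`, `s (−1) = 1` (fcc) / `−1` (hcp),
`s 1`, `s (−2)` read off the letters of layers `2`, `−2` modulo `3`; (i)/(ii) are the twin's explicit bridge
(`exists_site_eq_of_mem_fcc/hcp`, `cuboFrame_barlowPos_mem_fcc/hcp`, p161059); (iii) solves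
`z' = barlowSiteInt m u w (haggLabel s m)` from `6 ∣ Σz'`, `z'₀ ≡ z'₂ ≡ L + 2m (mod 3)` (letters only matter
modulo `3`: `siteVec m u w (L + 3) = siteVec m (u+1) (w+1) L`).  No definition is introduced (the flips are
produced by an existence lemma).  All `[folklore]`.
-/

noncomputable section

open Literature.MathematicalPhysics.StatisticalMechanics Literature.Geometry.DiscreteGeometry
open Literature.Geometry.DiscreteGeometry.TwoShellCheck (Ctx IVec flipVec)

namespace Summit.AtomisticToContinuum.Crystallization.Theorems.PhononSlackNearFieldConvexity

open Summit.AtomisticToContinuum.Crystallization.Theorems.NashClassCertificatesNashNearField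
  (cuboFrame_barlowPos_mem_fcc exists_site_eq_of_mem_fcc cuboFrame_barlowPos_mem_hcp exists_site_eq_of_mem_hcp)

/-! ### Letters of the five central layers
The landed `PrestressSplitKorn.haggLabel_one/two/neg_one/neg_two` (`L 1 = s 0`, `L 2 = s 0 + s 1`,
`L (−1) = −s (−1)`, `L (−2) = −s (−1) − s (−2)`) are reused. -/

open Summit.AtomisticToContinuum.Crystallization.Theorems.PrestressSplitKorn
  (haggLabel_one haggLabel_two haggLabel_neg_one haggLabel_neg_two)

/-! ### Coordinate sign flips of `ℝ³` -/

/-- **Coordinate sign flips exist as linear isometries**: for signs `σ i = ±1` there is `F : ℝ³ ≃ₗᵢ ℝ³`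
with `(F v) i = σ i · v i`. [folklore] -/
theorem tmpl_exists_flip (σ : Fin 3 → ℤ) (hσ : ∀ i, σ i = 1 ∨ σ i = -1) :
    ∃ F : EuclideanSpace ℝ (Fin 3) ≃ₗᵢ[ℝ] EuclideanSpace ℝ (Fin 3), ∀ (v : EuclideanSpace ℝ (Fin 3)) (i : Fin 3),
      F v i = (σ i : ℝ) * v i := by
  have hsq : ∀ i, ((σ i : ℝ)) * (σ i : ℝ) = 1 := fun i => by
    rcases hσ i with h | h <;> simp [h]
  let f : EuclideanSpace ℝ (Fin 3) → EuclideanSpace ℝ (Fin 3) := fun v => WithLp.toLp 2 fun i => (σ i : ℝ) * v i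
  have hf : ∀ v i, f v i = (σ i : ℝ) * v i := fun v i => rfl
  have hinv : Function.Involutive f := fun v => by
    ext i
    rw [hf, hf, ← mul_assoc, hsq, one_mul]
  let L : EuclideanSpace ℝ (Fin 3) →ₗ[ℝ] EuclideanSpace ℝ (Fin 3) :=
    { toFun := f
      map_add' := fun v w => by ext i; simp only [hf, PiLp.add_apply]; ring
      map_smul' := fun c v => by ext i; simp only [hf, PiLp.smul_apply, smul_eq_mul, RingHom.id_apply]; ring }
  have hL : ∀ v, L v = f v := fun v => rfl
  let Fe : EuclideanSpace ℝ (Fin 3) ≃ₗᵢ[ℝ] EuclideanSpace ℝ (Fin 3) :=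
    { LinearEquiv.ofInvolutive L (fun v => by rw [hL, hL]; exact hinv v) with
      norm_map' := fun v => by
        change ‖f v‖ = ‖v‖
        simp only [EuclideanSpace.norm_eq, hf, norm_mul, Real.norm_eq_abs]
        congr 1
        refine Finset.sum_congr rfl fun i _ => ?_
        rcases hσ i with h | h <;> simp [h] }
  exact ⟨Fe, fun v i => rfl⟩

/-- A sign flip acting on a scaled integer vector. [folklore] -/
theorem tmpl_flip_smul_intVec {F : EuclideanSpace ℝ (Fin 3) ≃ₗᵢ[ℝ] EuclideanSpace ℝ (Fin 3)} {σ : Fin 3 → ℤ}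
    (hF : ∀ (v : EuclideanSpace ℝ (Fin 3)) (i : Fin 3), F v i = (σ i : ℝ) * v i) (c : ℝ) (t : Fin 3 → ℤ) :
    F (c • intVec t) = c • intVec (fun i => σ i * t i) := by
  ext i
  rw [hF]
  simp only [PiLp.smul_apply, smul_eq_mul, intVec, Int.cast_mul]
  ring

/-- A sign flip with `σ i = ±1` is an involution. [folklore] -/
theorem tmpl_flip_flip {F : EuclideanSpace ℝ (Fin 3) ≃ₗᵢ[ℝ] EuclideanSpace ℝ (Fin 3)} {σ : Fin 3 → ℤ}
    (hF : ∀ (v : EuclideanSpace ℝ (Fin 3)) (i : Fin 3), F v i = (σ i : ℝ) * v i) (hσ : ∀ i, σ i = 1 ∨ σ i = -1)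
    (v : EuclideanSpace ℝ (Fin 3)) : F (F v) = v := by
  ext i
  rw [hF, hF, ← mul_assoc]
  rcases hσ i with h | h <;> simp [h]

/-- The sign table of the four flips of `TwoShellCheck` (`0` = identity, `k+1` negates coordinate `k`). [folklore] -/
theorem tmpl_sign_pm (k : Fin 4) (i : Fin 3) :
    (![![1, 1, 1], ![-1, 1, 1], ![1, -1, 1], ![1, 1, -1]] : Fin 4 → Fin 3 → ℤ) k i = 1 ∨
      (![![1, 1, 1], ![-1, 1, 1], ![1, -1, 1], ![1, 1, -1]] : Fin 4 → Fin 3 → ℤ) k i = -1 := by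
  fin_cases k <;> fin_cases i <;> simp

/-- `TwoShellCheck.flipVec` is the coordinatewise product with the sign table. [folklore] -/
theorem tmpl_toFun_flipVec (k : Fin 4) (z : IVec) :
    (flipVec k z).toFun = fun i => (![![1, 1, 1], ![-1, 1, 1], ![1, -1, 1], ![1, 1, -1]] : Fin 4 → Fin 3 → ℤ) k i * z.toFun i := by
  obtain ⟨a, b, c⟩ := z
  ext i
  fin_cases k <;> fin_cases i <;> simp [flipVec, IVec.toFun]

/-- `flipVec` is an involution. [folklore] -/
theorem tmpl_flipVec_flipVec (k : Fin 4) (z : IVec) : flipVec k (flipVec k z) = z := by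
  obtain ⟨a, b, c⟩ := z
  fin_cases k <;> simp [flipVec]

/-- The fcc integer model is invariant under the four flips. [folklore] -/
theorem tmpl_flip_mem_fccModelInt : ∀ k : Fin 4, ∀ t ∈ fccModelInt,
    (fun i => (![![1, 1, 1], ![-1, 1, 1], ![1, -1, 1], ![1, 1, -1]] : Fin 4 → Fin 3 → ℤ) k i * t i) ∈ fccModelInt := by
  decide

/-- **The flips preserve `fccTwoShellPattern`.** [folklore] -/
theorem tmpl_flip_mem_fccTwoShellPattern {F : EuclideanSpace ℝ (Fin 3) ≃ₗᵢ[ℝ] EuclideanSpace ℝ (Fin 3)} (k : Fin 4)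
    (hF : ∀ (v : EuclideanSpace ℝ (Fin 3)) (i : Fin 3),
      F v i = ((![![1, 1, 1], ![-1, 1, 1], ![1, -1, 1], ![1, 1, -1]] : Fin 4 → Fin 3 → ℤ) k i : ℝ) * v i)
    {v : EuclideanSpace ℝ (Fin 3)} (hv : v ∈ fccTwoShellPattern) : F v ∈ fccTwoShellPattern := by
  rw [fccTwoShellPattern_eq_image] at hv ⊢
  obtain ⟨t, ht, rfl⟩ := Finset.mem_image.1 hv
  rw [tmpl_flip_smul_intVec hF]
  exact Finset.mem_image_of_mem _ (tmpl_flip_mem_fccModelInt k t ht)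

/-! ### Solving the site equations -/

/-- **Site solving**: if `Σ z' = 6m` and `z'₀ ≡ z'₂ ≡ L + 2m (mod 3)` with `Lm ≡ L (mod 3)`, then
`z' = barlowSiteInt m u w Lm` for some integers `u w`. [folklore] -/
theorem tmpl_site_solve (z' : IVec) {m L Lm : ℤ} (hS : z'.1 + z'.2.1 + z'.2.2 = 6 * m)
    (h0 : (z'.1 - L - 2 * m) % 3 = 0) (h2 : (z'.2.2 - L - 2 * m) % 3 = 0) (hL : (Lm - L) % 3 = 0) :
    ∃ u w : ℤ, barlowSiteInt m u w Lm = z'.toFun := by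
  obtain ⟨a, b, c⟩ := z'
  simp only at hS h0 h2
  obtain ⟨u, hu⟩ : ∃ u : ℤ, a - Lm - 2 * m = 3 * u := ⟨(a - Lm - 2 * m) / 3, by omega⟩
  obtain ⟨w, hw⟩ : ∃ w : ℤ, c - Lm - 2 * m = 3 * w := ⟨(c - Lm - 2 * m) / 3, by omega⟩
  refine ⟨u, w, ?_⟩
  ext i
  fin_cases i <;> simp [barlowSiteInt, IVec.toFun] <;> omega

/-- Unfolding `Ctx.letter m = some L`: `m` is one of the five central layers with its letter. [folklore] -/
theorem tmpl_letter_elim (κ : Ctx) {m L : ℤ} (h : κ.letter m = some L) :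
    (m = -2 ∧ L = κ.lm2) ∨ (m = -1 ∧ L = κ.lm1) ∨ (m = 0 ∧ L = 0) ∨ (m = 1 ∧ L = κ.l1) ∨ (m = 2 ∧ L = κ.l2) := by
  unfold Ctx.letter at h
  split_ifs at h with h1 h2 h3 h4 h5 <;> simp only [Option.some.injEq] at h
  · exact Or.inl ⟨h1, h.symm⟩
  · exact Or.inr (Or.inl ⟨h2, h.symm⟩)
  · exact Or.inr (Or.inr (Or.inl ⟨h3, h.symm⟩))
  · exact Or.inr (Or.inr (Or.inr (Or.inl ⟨h4, h.symm⟩)))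
  · exact Or.inr (Or.inr (Or.inr (Or.inr ⟨h5, h.symm⟩)))

/-- Unfolding `Ctx.isSite z = true`: the flipped vector has coordinate sum `6m` for a layer `m` carrying a letter `L`
with `z'₀ ≡ z'₂ ≡ L + 2m (mod 3)`. [folklore] -/
theorem tmpl_isSite_elim (κ : Ctx) (z : IVec) (h : κ.isSite z = true) :
    ∃ m L : ℤ, κ.letter m = some L ∧
      (flipVec κ.flip z).1 + (flipVec κ.flip z).2.1 + (flipVec κ.flip z).2.2 = 6 * m ∧
      ((flipVec κ.flip z).1 - L - 2 * m) % 3 = 0 ∧ ((flipVec κ.flip z).2.2 - L - 2 * m) % 3 = 0 := by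
  unfold Ctx.isSite at h
  simp only [Bool.and_eq_true, beq_iff_eq] at h
  obtain ⟨h6, hrest⟩ := h
  set z' := flipVec κ.flip z with hz'
  set S := z'.1 + z'.2.1 + z'.2.2 with hSdef
  refine ⟨S / 6, ?_⟩
  cases hlet : κ.letter (S / 6) with
  | none => rw [hlet] at hrest; exact absurd hrest (by simp)
  | some L =>
    rw [hlet] at hrest
    simp only [Bool.and_eq_true, beq_iff_eq] at hrest
    refine ⟨L, rfl, by omega, hrest.1, hrest.2⟩

/-! ### The core construction -/

/-- **Core**: for a flip `k` and letters `(lm2, lm1, l1, l2)` of one of the two genuine families — hcp centre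
(`ct = true`: `k = 0`, `lm1 = l1 = 1`, `lm2, l2 ∈ {0, 2}`) or fcc centre (`ct = false`: `lm1 = 2`, `l1 = 1`, `lm2 ∈ {0,1}`,
`l2 ∈ {0,2}`) — the context `⟨k, lm2, lm1, l1, l2⟩` is realised by a template `(R, s)` with (i), (ii), (iii). [folklore] -/
theorem tmpl_core (ct : Bool) (k : Fin 4) (lm2 lm1 l1 l2 : ℤ)
    (hct : (ct = true ∧ k = 0 ∧ lm1 = 1 ∧ l1 = 1 ∧ (lm2 = 0 ∨ lm2 = 2) ∧ (l2 = 0 ∨ l2 = 2)) ∨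
      (ct = false ∧ lm1 = 2 ∧ l1 = 1 ∧ (lm2 = 0 ∨ lm2 = 1) ∧ (l2 = 0 ∨ l2 = 2))) :
    ∃ (R : EuclideanSpace ℝ (Fin 3) →ₗᵢ[ℝ] EuclideanSpace ℝ (Fin 3)) (s : ℤ → ℤ), IsHaggSeq s ∧
      (∀ v ∈ (if ct then hcpTwoShellPattern else fccTwoShellPattern), ∃ m u w : ℤ, R (barlowPos 1 (Real.sqrt 6 / 3) s m u w) = v) ∧
      (∀ m u w : ℤ, ‖barlowPos 1 (Real.sqrt 6 / 3) s m u w‖ ≤ 3 / 2 → barlowPos 1 (Real.sqrt 6 / 3) s m u w ≠ 0 →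
        R (barlowPos 1 (Real.sqrt 6 / 3) s m u w) ∈ (if ct then hcpTwoShellPattern else fccTwoShellPattern)) ∧
      (∀ z : IVec, Ctx.isSite ⟨k, lm2, lm1, l1, l2⟩ z = true →
        ∃ m u w : ℤ, R (barlowPos 1 (Real.sqrt 6 / 3) s m u w) = (Real.sqrt 18)⁻¹ • intVec z.toFun) := by
  -- the word
  set c₁ : ℤ := if l2 = 2 then 1 else -1 with hc₁
  set cm1 : ℤ := if ct then -1 else 1 with hcm1
  set cm2 : ℤ := if ct then (if lm2 = 0 then 1 else -1) else (if lm2 = 0 then -1 else 1) with hcm2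
  set s : ℤ → ℤ := fun i => if i = -1 then cm1 else if i = 1 then c₁ else if i = -2 then cm2 else 1 with hsdef
  have hs : IsHaggSeq s := by
    intro i
    simp only [hsdef, hc₁, hcm1, hcm2]
    split_ifs <;> simp
  have hs0 : s 0 = 1 := by simp [hsdef]
  have hsm1 : s (-1) = cm1 := by simp [hsdef]
  have hs1 : s 1 = c₁ := by simp [hsdef]
  have hsm2 : s (-2) = cm2 := by simp [hsdef]
  -- the letters modulo 3
  have hletters : ∀ m L : ℤ, Ctx.letter ⟨k, lm2, lm1, l1, l2⟩ m = some L → (haggLabel s m - L) % 3 = 0 := by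
    intro m L h
    rcases tmpl_letter_elim _ h with ⟨rfl, rfl⟩ | ⟨rfl, rfl⟩ | ⟨rfl, rfl⟩ | ⟨rfl, rfl⟩ | ⟨rfl, rfl⟩
    · rw [haggLabel_neg_two, hsm1, hsm2, hcm1, hcm2]
      rcases hct with ⟨rfl, -, -, -, hlm2, -⟩ | ⟨rfl, -, -, hlm2, -⟩ <;> rcases hlm2 with rfl | rfl <;> simp
    · rw [haggLabel_neg_one, hsm1, hcm1]
      rcases hct with ⟨rfl, -, rfl, -, -, -⟩ | ⟨rfl, rfl, -, -, -⟩ <;> simp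
    · simp
    · rw [haggLabel_one, hs0]
      rcases hct with ⟨-, -, -, rfl, -, -⟩ | ⟨-, -, rfl, -, -⟩ <;> decide
    · rw [haggLabel_two, hs0, hs1, hc₁]
      rcases hct with ⟨-, -, -, -, -, hl2⟩ | ⟨-, -, -, -, hl2⟩ <;> rcases hl2 with rfl | rfl <;> simp
  -- the frame: the sign flip of `k` after the cuboctahedral frame
  set σ : Fin 3 → ℤ := (![![1, 1, 1], ![-1, 1, 1], ![1, -1, 1], ![1, 1, -1]] : Fin 4 → Fin 3 → ℤ) k with hσ
  have hσpm : ∀ i, σ i = 1 ∨ σ i = -1 := fun i => tmpl_sign_pm k i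
  obtain ⟨F, hF⟩ := tmpl_exists_flip σ hσpm
  -- `F` preserves the centre's pattern (identity on coordinates for hcp: `k = 0`)
  have hFpat : ∀ v, v ∈ (if ct then hcpTwoShellPattern else fccTwoShellPattern) →
      F v ∈ (if ct then hcpTwoShellPattern else fccTwoShellPattern) := by
    intro v hv
    rcases hct with ⟨rfl, rfl, -, -, -, -⟩ | ⟨rfl, -, -, -, -⟩
    · have : F v = v := by
        ext i
        rw [hF]
        fin_cases i <;> simp [hσ]
      simpa [this] using hv
    · simp only [Bool.false_eq_true, ↓reduceIte] at hv ⊢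
      exact tmpl_flip_mem_fccTwoShellPattern k (by simpa [hσ] using hF) hv
  refine ⟨F.toLinearIsometry.comp cuboFrame, s, hs, ?_, ?_, ?_⟩
  · -- (i): pattern ⊆ R(sites)
    intro v hv
    have hv' := hFpat v hv
    rcases hct with ⟨rfl, -, -, -, -, -⟩ | ⟨rfl, -, -, -, -⟩
    · simp only [↓reduceIte] at hv' ⊢
      obtain ⟨m, u, w, -, hmw⟩ := exists_site_eq_of_mem_hcp hs0 (by rw [hsm1, hcm1]; simp) hv'
      exact ⟨m, u, w, by rw [LinearIsometry.coe_comp, Function.comp_apply, hmw]; exact tmpl_flip_flip hF hσpm v⟩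
    · simp only [Bool.false_eq_true, ↓reduceIte] at hv' ⊢
      obtain ⟨m, u, w, -, hmw⟩ := exists_site_eq_of_mem_fcc hs0 (by rw [hsm1, hcm1]; simp) hv'
      exact ⟨m, u, w, by rw [LinearIsometry.coe_comp, Function.comp_apply, hmw]; exact tmpl_flip_flip hF hσpm v⟩
  · -- (ii): central non-zero sites ↦ pattern
    intro m u w hle hne
    rw [LinearIsometry.coe_comp, Function.comp_apply]
    refine hFpat _ ?_
    rcases hct with ⟨rfl, -, -, -, -, -⟩ | ⟨rfl, -, -, -, -⟩
    · simp only [↓reduceIte]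
      exact cuboFrame_barlowPos_mem_hcp hs0 (by rw [hsm1, hcm1]; simp) hle hne
    · simp only [Bool.false_eq_true, ↓reduceIte]
      exact cuboFrame_barlowPos_mem_fcc hs0 (by rw [hsm1, hcm1]; simp) hle hne
  · -- (iii): every accepted model vector is R of a template site
    intro z hz
    obtain ⟨m, L, hlet, hS, h0, h2⟩ := tmpl_isSite_elim _ z hz
    obtain ⟨u, w, huw⟩ := tmpl_site_solve (flipVec k z) hS h0 h2 (hletters m L hlet)
    refine ⟨m, u, w, ?_⟩
    rw [LinearIsometry.coe_comp, Function.comp_apply, cuboFrame_barlowPos, huw]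
    change F ((Real.sqrt 18)⁻¹ • intVec (flipVec k z).toFun) = _
    rw [tmpl_flip_smul_intVec hF, tmpl_toFun_flipVec k z]
    congr 1
    congr 1
    ext i
    rw [← mul_assoc]
    rcases hσpm i with h | h <;> simp [hσ] at h ⊢ <;> simp [h]

/-- **Registered piece `stub_labelledPlacementTemplate` (TEMPLATE-OF-CONTEXT) of `stub_labelledPlacement`**: every
letter context of the two genuine families is realised by an ideal Barlow template `(R, s)` satisfying the bridge
clauses (i), (ii) for the centre's pattern and mapping every `κ.isSite` model vector to a template site. [folklore] -/
theorem stub_labelledPlacementTemplate : ∀ (ct : Bool) (κ : Literature.Geometry.DiscreteGeometry.TwoShellCheck.Ctx), κ ∈ (if ct then [⟨0,0,1,1,0⟩,⟨0,0,1,1,2⟩,⟨0,2,1,1,0⟩,⟨0,2,1,1,2⟩] else [⟨0,0,2,1,0⟩,⟨0,0,2,1,2⟩,⟨0,1,2,1,0⟩,⟨0,1,2,1,2⟩,⟨1,0,2,1,0⟩,⟨1,0,2,1,2⟩,⟨1,1,2,1,0⟩,⟨1,1,2,1,2⟩,⟨2,0,2,1,0⟩,⟨2,0,2,1,2⟩,⟨2,1,2,1,0⟩,⟨2,1,2,1,2⟩,⟨3,0,2,1,0⟩,⟨3,0,2,1,2⟩,⟨3,1,2,1,0⟩,⟨3,1,2,1,2⟩]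 : List Literature.Geometry.DiscreteGeometry.TwoShellCheck.Ctx) → ∃ (R : EuclideanSpace ℝ (Fin 3) →ₗᵢ[ℝ] EuclideanSpace ℝ (Fin 3)) (s : ℤ → ℤ), IsHaggSeq s ∧ (∀ v ∈ (if ct then hcpTwoShellPattern else fccTwoShellPattern), ∃ m u w : ℤ, R (barlowPos 1 (Real.sqrt 6 / 3) s m u w) = v) ∧ (∀ m u w : ℤ, ‖barlowPos 1 (Real.sqrt 6 / 3) s m u w‖ ≤ 3 / 2 → barlowPos 1 (Real.sqrt 6 / 3) s m u w ≠ 0 → R (barlowPos 1 (Real.sqrt 6 / 3) s m u w) ∈ (if ct then hcpTwoShellPattern else fccTwoShellPattern)) ∧ (∀ z : Literature.Geometry.DiscreteGeometry.TwoShellCheck.IVec, κ.isSite z = true → ∃ m u w : ℤ, R (barlowPos 1 (Real.sqrt 6 / 3) s m u w) = (Real.sqrt 18)⁻¹ • intVec z.toFun) := by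
  intro ct κ hκ
  obtain ⟨k, lm2, lm1, l1, l2⟩ := κ
  refine tmpl_core ct k lm2 lm1 l1 l2 ?_
  cases ct
  · simp only [Bool.false_eq_true, ↓reduceIte, List.mem_cons, Ctx.mk.injEq, List.not_mem_nil, or_false] at hκ
    right
    rcases hκ with h | h | h | h | h | h | h | h | h | h | h | h | h | h | h | h <;>
      obtain ⟨rfl, rfl, rfl, rfl, rfl⟩ := h <;> simp
  · simp only [↓reduceIte, List.mem_cons, Ctx.mk.injEq, List.not_mem_nil, or_false] at hκ
    left
    rcases hκ with h | h | h | h <;> obtain ⟨rfl, rfl, rfl, rfl, rfl⟩ := h <;> simp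

end Summit.AtomisticToContinuum.Crystallization.Theorems.PhononSlackNearFieldConvexity
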